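import Mathlib
import Summits.Ventures.HodgeRepro2.PeterssonPreInner
import Summits.Ventures.HodgeRepro2.PeterssonCompactQuotient
import Summits.Ventures.HodgeRepro2.HeckeSlashSelfAdjoint
import Summits.Ventures.HodgeRepro2.HeckeCommensurable
import Summits.Ventures.HodgeRepro2.SeparationQuotientOperators

/-!
# PeterssonSpace — the Petersson inner product space of the compact Picard modular surface and
its Hecke operators

Blind cell `pub-hodge-repro2`, seat p2 (Tier 5 kernel support, Hecke side of N1 §ID-3 / N3 / N5).

`PeterssonPreInner.lean` (row 116) packaged the Petersson product of continuous weight-`k`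
functions for `S` on the ball, against the quotient measure carried by a fundamental domain `D` of
a compact quotient `S\𝔹²`, as Mathlib's `PreInnerProductSpace.Core`. This file

* turns it into a seminormed inner product space `PeterssonForms hQ S hS k hD` (a type synonym of
  `weightForms τ₁ Q S k` carrying the data `D`) and into an honest inner product space, the
  **Petersson space** `PeterssonSpace hQ S hS k hD := SeparationQuotient (PeterssonForms …)`
  (functions vanishing on the ball are identified with `0`);
* realises the Hecke operators `T_δ` (`HeckeSlashOperator.lean`, row 114) as linear maps
  `heckeForms` on the weight-`k` forms, shows that `(T_δ, T_{δ⁻¹})` is a formal adjoint pair for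
  the Petersson product (`HeckeSlashSelfAdjoint.lean`, row 115, read in Mathlib's convention
  `⟪f, g⟫ = ⟨g, f⟩_Pet`), and descends them to the Petersson space (`heckeSpace`);
* **Hecke eigenforms**: for a congruence subgroup `Γ_{N'} ≤ S ≤ Γ_1` (`HeckeCommensurable.lean`,
  row 117, supplies the finiteness of `S/S_δ`), any finite-dimensional subspace `V` of the
  Petersson space stable under a family of Hecke operators closed under `δ ↦ δ⁻¹` and commuting
  pairwise has an ORTHONORMAL BASIS of simultaneous Hecke eigenvectors
  (`exists_orthonormalBasis_heckeSpace`).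

What stays prose: that the holomorphic weight-`k` forms span a finite-dimensional Hecke-stable
subspace (finiteness of `S_k(Γ)` on a compact quotient) and the commutativity of the Hecke
operators away from the level.
-/

namespace Summit.Ventures.HodgeRepro2.ShimuraData

open JointEigenbasis SeparationQuotientOperators

variable {K : Type*} [Field K] [NumberField K] [NumberField.IsCMField K] {τ₁ : K →+* ℂ}
  {H : Matrix (Fin 3) (Fin 3) K} {Q : Matrix (Fin 3) (Fin 3) ℂ}

/-- The continuous weight-`k` functions for `S` on the ball, as a type carrying the Petersson
pre-inner-product structure attached to the fundamental domain `D` (type synonym of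
`weightForms τ₁ Q S k`; the arguments `hQ`, `hS`, the compactness instance and `hD` are the data
of the Petersson product). -/
def PeterssonForms (hQ : IsFrame K τ₁ H Q) (S : Subgroup (GL (Fin 3) K))
    (hS : (S : Set (GL (Fin 3) K)) ⊆ unitaryGroup K H) [CompactSpace (ballQuotient hQ S hS)]
    {D : Set ball₂} (k : ℕ) (_hD : IsBallFundamentalDomain hQ S hS D) : Type _ :=
  weightForms τ₁ Q S k

variable (hQ : IsFrame K τ₁ H Q) (S : Subgroup (GL (Fin 3) K))
  (hS : (S : Set (GL (Fin 3) K)) ⊆ unitaryGroup K H) [CompactSpace (ballQuotient hQ S hS)]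
  {D : Set ball₂} (k : ℕ) (hD : IsBallFundamentalDomain hQ S hS D)

namespace PeterssonForms

/-- A weight-`k` form as an element of `PeterssonForms`. -/
def ofForm (f : weightForms τ₁ Q S k) : PeterssonForms hQ S hS k hD := f

/-- The underlying weight-`k` form. -/
def toForm (f : PeterssonForms hQ S hS k hD) : weightForms τ₁ Q S k := f

/-- The Petersson seminorm `‖f‖ = √⟨f, f⟩` on the weight-`k` forms (the additive group and the
`ℂ`-module structure of `PeterssonForms` are derived from this instance and the next one, so that
no instance diamond arises). -/
noncomputable instance : SeminormedAddCommGroup (PeterssonForms hQ S hS k hD) :=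
  @InnerProductSpace.Core.toSeminormedAddCommGroup ℂ (weightForms τ₁ Q S k) _ _ _
    (peterssonCore hQ S hS k hD)

/-- The Petersson product as a (pre-)inner product space structure on the weight-`k` forms. -/
noncomputable instance : InnerProductSpace ℂ (PeterssonForms hQ S hS k hD) :=
  InnerProductSpace.ofCore (peterssonCore hQ S hS k hD)

/-- The inner product of `PeterssonForms` is the Petersson product in Mathlib's convention
(conjugate-linear in the first slot): `⟪f, g⟫ = ⟨g, f⟩_Pet`. -/
theorem inner_def (f g : PeterssonForms hQ S hS k hD) :
    inner ℂ f g = peterssonInner hQ S hS (quotientMeasure hQ S hS D)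
      ((mem_weightForms τ₁ Q S k).mp (toForm hQ S hS k hD g).2).1
      ((mem_weightForms τ₁ Q S k).mp (toForm hQ S hS k hD f).2).1 := rfl

end PeterssonForms

/-- **The Petersson space** of `S\𝔹²`: the separation quotient of the weight-`k` forms for the
Petersson seminorm — an honest inner product space (Mathlib's `SeparationQuotient` instances). -/
abbrev PeterssonSpace : Type _ := SeparationQuotient (PeterssonForms hQ S hS k hD)

/-- The Petersson seminorm of a form vanishes iff the form vanishes on the ball
(`PeterssonCompactQuotient.peterssonInner_self_eq_zero_iff_of_compactSpace`). -/
theorem PeterssonForms.norm_eq_zero_iff (f : PeterssonForms hQ S hS k hD) :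
    ‖f‖ = 0 ↔ ∀ z ∈ ball₂, (PeterssonForms.toForm hQ S hS k hD f : (Fin 2 → ℂ) → ℂ) z = 0 := by
  rw [← peterssonInner_self_eq_zero_iff_of_compactSpace hQ S hS hD
    ((mem_weightForms τ₁ Q S k).mp (PeterssonForms.toForm hQ S hS k hD f).2).1
    ((mem_weightForms τ₁ Q S k).mp (PeterssonForms.toForm hQ S hS k hD f).2).2,
    ← PeterssonForms.inner_def hQ S hS k hD f f]
  constructor
  · intro h
    have h1 : ‖f‖ ^ 2 = 0 := by rw [h]; norm_num
    rw [norm_sq_eq_re_inner (𝕜 := ℂ)] at h1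
    exact Complex.ext h1 (inner_self_im (𝕜 := ℂ) f)
  · intro h
    have h1 : ‖f‖ ^ 2 = 0 := by rw [norm_sq_eq_re_inner (𝕜 := ℂ), h, map_zero]
    exact pow_eq_zero_iff two_ne_zero |>.mp h1

/-- **Two forms have the same class in the Petersson space iff they agree on the ball.** -/
theorem PeterssonSpace.mk_eq_mk_iff (f g : PeterssonForms hQ S hS k hD) :
    (SeparationQuotient.mk f : PeterssonSpace hQ S hS k hD) = SeparationQuotient.mk g
      ↔ ∀ z ∈ ball₂, (PeterssonForms.toForm hQ S hS k hD f : (Fin 2 → ℂ) → ℂ) z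
        = (PeterssonForms.toForm hQ S hS k hD g : (Fin 2 → ℂ) → ℂ) z := by
  rw [SeparationQuotient.mk_eq_mk, Metric.inseparable_iff, dist_eq_norm,
    PeterssonForms.norm_eq_zero_iff]
  show (∀ z ∈ ball₂, ((PeterssonForms.toForm hQ S hS k hD f - PeterssonForms.toForm hQ S hS k hD g :
    weightForms τ₁ Q S k) : (Fin 2 → ℂ) → ℂ) z = 0) ↔ _
  simp only [Submodule.coe_sub, Pi.sub_apply, sub_eq_zero]

section hecke

variable {δ : GL (Fin 3) K} (hδ : δ ∈ unitaryGroup K H)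
  [Fintype (S ⧸ (heckeSubgroup S δ).subgroupOf S)]

/-- The Hecke operator `T_δ` as a linear map on the weight-`k` forms. -/
noncomputable def heckeForms : PeterssonForms hQ S hS k hD →ₗ[ℂ] PeterssonForms hQ S hS k hD where
  toFun f := PeterssonForms.ofForm hQ S hS k hD
    ⟨hecke S δ τ₁ Q k (PeterssonForms.toForm hQ S hS k hD f),
      (mem_weightForms τ₁ Q S k).mpr
        ⟨IsWeightFor.hecke hQ S hS hδ
          ((mem_weightForms τ₁ Q S k).mp (PeterssonForms.toForm hQ S hS k hD f).2).1,
        continuousOn_hecke hQ S hS hδ k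
          ((mem_weightForms τ₁ Q S k).mp (PeterssonForms.toForm hQ S hS k hD f).2).2⟩⟩
  map_add' f g := by
    apply Subtype.ext
    funext z
    change hecke S δ τ₁ Q k (f.1 + g.1) z = hecke S δ τ₁ Q k f.1 z + hecke S δ τ₁ Q k g.1 z
    simp only [hecke, slash_add, Pi.add_apply, Finset.sum_add_distrib]
  map_smul' c f := by
    apply Subtype.ext
    funext z
    change hecke S δ τ₁ Q k (c • f.1) z = c * hecke S δ τ₁ Q k f.1 z
    simp only [hecke, slash_smul, Pi.smul_apply, smul_eq_mul, Finset.mul_sum]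

/-- The underlying function of `T_δ f`. -/
theorem heckeForms_apply_coe (f : PeterssonForms hQ S hS k hD) :
    ((PeterssonForms.toForm hQ S hS k hD (heckeForms hQ S hS k hD hδ f) : weightForms τ₁ Q S k) :
      (Fin 2 → ℂ) → ℂ) = hecke S δ τ₁ Q k (PeterssonForms.toForm hQ S hS k hD f) := rfl

variable [Fintype (S ⧸ (heckeSubgroup S δ⁻¹).subgroupOf S)]

/-- **`(T_δ, T_{δ⁻¹})` is a formal adjoint pair** for the Petersson inner product
(`HeckeSlashSelfAdjoint.peterssonInner_hecke_adjoint` read in Mathlib's convention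
`⟪f, g⟫ = ⟨g, f⟩_Pet`). -/
theorem inner_heckeForms_adjoint (hDm : MeasurableSet D) (f g : PeterssonForms hQ S hS k hD) :
    inner ℂ (heckeForms hQ S hS k hD hδ f) g
      = inner ℂ f (heckeForms hQ S hS k hD (inv_mem hδ) g) := by
  rw [PeterssonForms.inner_def, PeterssonForms.inner_def]
  rw [peterssonInner_swap hQ S hS _
    ((mem_weightForms τ₁ Q S k).mp (PeterssonForms.toForm hQ S hS k hD
      (heckeForms hQ S hS k hD hδ f)).2).1
    ((mem_weightForms τ₁ Q S k).mp (PeterssonForms.toForm hQ S hS k hD g).2).1]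
  rw [peterssonInner_swap hQ S hS _
    ((mem_weightForms τ₁ Q S k).mp (PeterssonForms.toForm hQ S hS k hD f).2).1
    ((mem_weightForms τ₁ Q S k).mp (PeterssonForms.toForm hQ S hS k hD
      (heckeForms hQ S hS k hD (inv_mem hδ) g)).2).1]
  congr 1
  exact peterssonInner_hecke_adjoint hQ S hS hδ hDm hD
    ((mem_weightForms τ₁ Q S k).mp (PeterssonForms.toForm hQ S hS k hD f).2).1
    ((mem_weightForms τ₁ Q S k).mp (PeterssonForms.toForm hQ S hS k hD g).2).1
    ((mem_weightForms τ₁ Q S k).mp (PeterssonForms.toForm hQ S hS k hD f).2).2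
    ((mem_weightForms τ₁ Q S k).mp (PeterssonForms.toForm hQ S hS k hD g).2).2

/-- `T_δ` maps Petersson-null forms to Petersson-null forms. -/
theorem norm_heckeForms_eq_zero (hDm : MeasurableSet D) :
    ∀ f : PeterssonForms hQ S hS k hD, ‖f‖ = 0 → ‖heckeForms hQ S hS k hD hδ f‖ = 0 :=
  norm_apply_eq_zero_of_isFormalAdjointPair' _ _ (inner_heckeForms_adjoint hQ S hS k hD hδ hDm)

/-- **The Hecke operator `T_δ` on the Petersson space** (descended from the weight-`k` forms). -/
noncomputable def heckeSpace (hDm : MeasurableSet D) :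
    PeterssonSpace hQ S hS k hD →ₗ[ℂ] PeterssonSpace hQ S hS k hD :=
  descendSQ (heckeForms hQ S hS k hD hδ) (norm_heckeForms_eq_zero hQ S hS k hD hδ hDm)

/-- `T_δ (mk f) = mk (T_δ f)`. -/
theorem heckeSpace_mk (hDm : MeasurableSet D) (f : PeterssonForms hQ S hS k hD) :
    heckeSpace hQ S hS k hD hδ hDm (SeparationQuotient.mk f)
      = SeparationQuotient.mk (heckeForms hQ S hS k hD hδ f) := rfl

end hecke

section eigenforms

variable {𝔪 : Submodule ℤ (Fin 3 → K)} (h𝔪 : IsLattice K 𝔪) (hS₁ : S ≤ shimuraLevelSubgroup K H 𝔪 1)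
  {N' : ℕ} (hN' : N' ≠ 0) (hSN' : shimuraLevelSubgroup K H 𝔪 N' ≤ S) (hDm : MeasurableSet D)

/-- The Hecke operators on the Petersson space of a congruence subgroup `Γ_{N'} ≤ S ≤ Γ_1`, indexed
by the rational unitary group `U(H)(K)` (the finiteness of `S/S_δ` is `HeckeCommensurable.lean`). -/
noncomputable def heckeFamily (δ : unitaryGroup K H) :
    PeterssonSpace hQ S hS k hD →ₗ[ℂ] PeterssonSpace hQ S hS k hD :=
  letI := fintypeHeckeQuotient h𝔪 hS₁ hN' hSN' δ.2
  letI := fintypeHeckeQuotient h𝔪 hS₁ hN' hSN' (inv_mem δ.2)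
  heckeSpace hQ S hS k hD δ.2 hDm

/-- `(T_δ, T_{δ⁻¹})` is a formal adjoint pair on the Petersson space. -/
theorem isFormalAdjointPair_heckeFamily (δ : unitaryGroup K H) :
    IsFormalAdjointPair (heckeFamily hQ S hS k hD h𝔪 hS₁ hN' hSN' hDm δ)
      (heckeFamily hQ S hS k hD h𝔪 hS₁ hN' hSN' hDm δ⁻¹) := by
  letI := fintypeHeckeQuotient h𝔪 hS₁ hN' hSN' δ.2
  letI := fintypeHeckeQuotient h𝔪 hS₁ hN' hSN' (inv_mem δ.2)
  letI := fintypeHeckeQuotient h𝔪 hS₁ hN' hSN' (inv_mem (inv_mem δ.2))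
  exact isFormalAdjointPair_descendSQ _ _ (inner_heckeForms_adjoint hQ S hS k hD δ.2 hDm)
    (norm_heckeForms_eq_zero hQ S hS k hD δ.2 hDm)
    (norm_heckeForms_eq_zero hQ S hS k hD (inv_mem δ.2) hDm)

/-- **Simultaneous Hecke eigenforms.** Let `Γ_{N'} ≤ S ≤ Γ_1` be a congruence subgroup with
`S\𝔹²` compact, `D` a measurable fundamental domain, `δ : ι → U(H)(K)` a family of rational
unitary matrices closed under inversion (`δ (σ i) = (δ i)⁻¹`) whose Hecke operators commute
pairwise on the Petersson space, and `V` a finite-dimensional subspace of the Petersson space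
stable under every `T_{δ i}`. Then `V` has an orthonormal basis of simultaneous eigenvectors of
all the `T_{δ i}`. -/
theorem exists_orthonormalBasis_heckeSpace {ι : Type*} (δ : ι → unitaryGroup K H) (σ : ι → ι)
    (hσ : ∀ i, δ (σ i) = (δ i)⁻¹)
    (hcomm : ∀ i j, Commute (heckeFamily hQ S hS k hD h𝔪 hS₁ hN' hSN' hDm (δ i))
      (heckeFamily hQ S hS k hD h𝔪 hS₁ hN' hSN' hDm (δ j)))
    (V : Submodule ℂ (PeterssonSpace hQ S hS k hD)) [FiniteDimensional ℂ V]
    (hV : ∀ i, ∀ v ∈ V, heckeFamily hQ S hS k hD h𝔪 hS₁ hN' hSN' hDm (δ i) v ∈ V) :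
    ∃ b : OrthonormalBasis (Fin (Module.finrank ℂ V)) ℂ V, ∀ a i, ∃ μ : ℂ,
      heckeFamily hQ S hS k hD h𝔪 hS₁ hN' hSN' hDm (δ i) (b a) = μ • (b a : PeterssonSpace hQ S hS k hD) := by
  refine exists_orthonormalBasis_of_isFormalAdjointPair_of_commute_restrict
    (fun i => heckeFamily hQ S hS k hD h𝔪 hS₁ hN' hSN' hDm (δ i)) σ (fun i => ?_) hcomm V hV
  rw [hσ i]
  exact isFormalAdjointPair_heckeFamily hQ S hS k hD h𝔪 hS₁ hN' hSN' hDm (δ i)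

end eigenforms

end Summit.Ventures.HodgeRepro2.ShimuraData
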